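import Summits.QuantumAdvantage.QuantumAdvantage.Theorems.HankelLiftBeyondRectanglesForsterSpectral

/-!
# Forster's Theorem 4.1, part IIb: coercivity of the log-volume functional

Route `route-QuantumAdvantage-HankelLift`; infrastructure toward discharging the named fact
`Literature.Computability.Complexity.ForsterIsotropicPosition` (Forster 2002, Thm 4.1).

For `Φ(A) = ∑_x log ‖A u_x‖² − (|X|/k)·log (det A)²` this file proves COERCIVITY on the unit
Frobenius sphere: if `u` is in quantitative general position with constant `δ₀` (for every
orthonormal basis `(e_j)` and nonempty `U ⊊ [k]`, at most `k − |U|` of the `u_x` have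
`⟨e_i,u_x⟩² < δ₀` for all `i ∈ U`), then for every `A` with `∑ A_{ij}² = 1` and `det A ≠ 0`,
`Φ(A) ≥ |X| log δ₀ − ((|X|−k)/k) log k + ((|X|−k)/k²)·log(1/det(A)²)` (`coercive_bound`), so
`Φ → +∞` as `det A → 0` when `|X| > k`.  Ingredients: `spectral_data` (part IIa), for each `x` the
largest eigenvalue whose eigenvector sees `u_x`, and the discrete layer-cake (Abel summation)
inequality `layer_cake` over the sorted eigenvalues (`Tuple.sort`).
[cite: Forster2002, Theorem 4.1 (Lemma 4.2, compactness)]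
-/

set_option linter.dupNamespace false -- D-0017: single-problem summit ⇒ `QuantumAdvantage.QuantumAdvantage` by design

noncomputable section

namespace Summit.QuantumAdvantage.QuantumAdvantage.Theorems.HankelLift.Forster

open Finset Real Matrix

/-! ## The layer-cake inequality -/

/-- A truncated sum over `range K` equals the sum over `range m` for `m ≤ K`. [folklore] -/
theorem sum_range_ite_lt (K m : ℕ) (hm : m ≤ K) (g : ℕ → ℝ) :
    ∑ l ∈ Finset.range K, (if l < m then g l else 0) = ∑ l ∈ Finset.range m, g l := by
  rw [← Finset.sum_filter]
  congr 1
  ext l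
  simp only [Finset.mem_filter, Finset.mem_range]
  omega

/-- **Layer-cake (Abel summation) inequality.**  Let `λ : [k] → ℝ_{>0}`, `f : X → [k]` with
`|X| ≥ k ≥ 1`, such that for every threshold `t` whose upper set `U_t = {j : t ≤ λ_j}` is a
nonempty proper subset, at most `k − |U_t|` points `x` have `λ_{f(x)} < t`.  Then for all `j_M, j_m`:
`((|X|−k)/k)·(log λ_{j_M} − log λ_{j_m}) ≤ ∑_x log λ_{f(x)} − (|X|/k) ∑_j log λ_j`.
(Sort the `λ_j`; telescope `log` along the sorted order; compare the two counting functions level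
by level.) [folklore] -/
theorem layer_cake {X : Type*} [Fintype X] {k : ℕ} (hk : 1 ≤ k) (hn : k ≤ Fintype.card X)
    (lam : Fin k → ℝ) (hpos : ∀ j, 0 < lam j) (f : X → Fin k)
    (hcount : ∀ t : ℝ, (Finset.univ.filter fun j => t ≤ lam j).Nonempty →
      (Finset.univ.filter fun j => t ≤ lam j).card < k →
      (Finset.univ.filter fun x => lam (f x) < t).card ≤
        k - (Finset.univ.filter fun j => t ≤ lam j).card)
    (jM jm : Fin k) :
    ((Fintype.card X : ℝ) - k) / k * (Real.log (lam jM) - Real.log (lam jm)) ≤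
      ∑ x, Real.log (lam (f x)) - (Fintype.card X : ℝ) / k * ∑ j, Real.log (lam j) := by
  classical
  set n : ℕ := Fintype.card X with hndef
  -- sort the eigenvalues
  set σ : Equiv.Perm (Fin k) := Tuple.sort lam with hσ
  have hmono : Monotone (lam ∘ σ) := Tuple.monotone_sort lam
  -- positions as naturals, values by position
  let idx : ℕ → Fin k := fun m => ⟨min m (k - 1), by omega⟩
  have hidx : ∀ m, m < k → (idx m : ℕ) = m := fun m hm => by simp [idx]; omega
  have hidx_mono : Monotone idx := fun a b hab => by
    show min a (k - 1) ≤ min b (k - 1)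
    exact min_le_min_right _ hab
  let ν : ℕ → ℝ := fun m => Real.log (lam (σ (idx m)))
  have hνmono : Monotone ν := fun a b hab =>
    Real.log_le_log (hpos _) (hmono (hidx_mono hab))
  set g : ℕ → ℝ := fun l => ν (l + 1) - ν l with hgdef
  have hg0 : ∀ l, 0 ≤ g l := fun l => sub_nonneg.mpr (hνmono (Nat.le_succ l))
  let p : X → ℕ := fun x => (σ.symm (f x) : ℕ)
  have hplt : ∀ x, p x < k := fun x => (σ.symm (f x)).isLt
  have hidxp : ∀ x, idx (p x) = σ.symm (f x) := fun x => Fin.ext (hidx _ (hplt x))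
  have hνp : ∀ x, ν (p x) = Real.log (lam (f x)) := by
    intro x; simp only [ν, hidxp, Equiv.apply_symm_apply]
  -- telescoping
  have htel : ∀ m, ν m = ν 0 + ∑ l ∈ Finset.range m, g l := by
    intro m
    rw [Finset.sum_range_sub (f := ν), add_sub_cancel]
  have htel' : ∀ m, m ≤ k - 1 → ν m = ν 0 + ∑ l ∈ Finset.range (k - 1), (if l < m then g l else 0) := by
    intro m hm; rw [sum_range_ite_lt _ _ hm, htel m]
  -- the two sums, level by level
  have hA : ∑ x, Real.log (lam (f x)) = n * ν 0 +
      ∑ l ∈ Finset.range (k - 1), g l * ((Finset.univ.filter fun x => l < p x).card : ℝ) := by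
    calc ∑ x, Real.log (lam (f x)) = ∑ x, ν (p x) := by simp_rw [hνp]
      _ = ∑ x, (ν 0 + ∑ l ∈ Finset.range (k - 1), (if l < p x then g l else 0)) :=
          Finset.sum_congr rfl fun x _ => htel' (p x) (by have := hplt x; omega)
      _ = n * ν 0 + ∑ x, ∑ l ∈ Finset.range (k - 1), (if l < p x then g l else 0) := by
          rw [Finset.sum_add_distrib, Finset.sum_const, Finset.card_univ, nsmul_eq_mul]
      _ = n * ν 0 + ∑ l ∈ Finset.range (k - 1), g l *
            ((Finset.univ.filter fun x => l < p x).card : ℝ) := by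
          congr 1
          rw [Finset.sum_comm]
          refine Finset.sum_congr rfl fun l _ => ?_
          rw [← Finset.sum_filter, Finset.sum_const, nsmul_eq_mul, mul_comm]
  have hB : ∑ j, Real.log (lam j) = k * ν 0 +
      ∑ l ∈ Finset.range (k - 1), g l * ((k : ℝ) - 1 - l) := by
    have h1 : ∑ j, Real.log (lam j) = ∑ i : Fin k, ν i := by
      rw [← Equiv.sum_comp σ (fun j => Real.log (lam j))]
      refine Finset.sum_congr rfl fun i _ => ?_
      simp only [ν]
      exact congrArg (fun j => Real.log (lam (σ j))) (Fin.ext (hidx i i.isLt)).symm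
    rw [h1, Fin.sum_univ_eq_sum_range (fun m => ν m) k]
    calc ∑ m ∈ Finset.range k, ν m
        = ∑ m ∈ Finset.range k, (ν 0 + ∑ l ∈ Finset.range (k - 1), (if l < m then g l else 0)) :=
          Finset.sum_congr rfl fun m hm => htel' m (by have := Finset.mem_range.mp hm; omega)
      _ = k * ν 0 + ∑ m ∈ Finset.range k, ∑ l ∈ Finset.range (k - 1), (if l < m then g l else 0) := by
          rw [Finset.sum_add_distrib, Finset.sum_const, Finset.card_range, nsmul_eq_mul]
      _ = k * ν 0 + ∑ l ∈ Finset.range (k - 1), g l * ((k : ℝ) - 1 - l) := by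
          congr 1
          rw [Finset.sum_comm]
          refine Finset.sum_congr rfl fun l hl => ?_
          rw [← Finset.sum_filter, Finset.sum_const, nsmul_eq_mul, mul_comm]
          congr 1
          have hl' := Finset.mem_range.mp hl
          have : (Finset.range k).filter (fun m => l < m) = Finset.Ico (l + 1) k := by
            ext m; simp [Finset.mem_filter, Finset.mem_range, Finset.mem_Ico]; omega
          rw [this, Nat.card_Ico]
          have : l + 1 ≤ k := by omega
          rw [Nat.cast_sub this]
          push_cast
          ring
  -- the count at each level with a positive gap
  have hN : ∀ l, l < k - 1 → g l * ((n : ℝ) - l - 1) ≤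
      g l * ((Finset.univ.filter fun x => l < p x).card : ℝ) := by
    intro l hl
    rcases eq_or_lt_of_le (hg0 l) with h0 | hpos'
    · rw [← h0]; simp
    refine mul_le_mul_of_nonneg_left ?_ (hg0 l)
    -- threshold `t = λ_{σ(l+1)}`
    have hl1 : l + 1 < k := by omega
    set t : ℝ := lam (σ ⟨l + 1, hl1⟩) with ht
    have hgap : lam (σ ⟨l, by omega⟩) < t := by
      have : ν l < ν (l + 1) := by
        have := hpos'; simp only [hgdef] at this; linarith
      simp only [ν] at this
      have e1 : idx l = ⟨l, by omega⟩ := Fin.ext (hidx l (by omega))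
      have e2 : idx (l + 1) = ⟨l + 1, hl1⟩ := Fin.ext (hidx (l + 1) hl1)
      rw [e1, e2] at this
      exact (Real.log_lt_log_iff (hpos _) (hpos _)).mp this
    set Ut := Finset.univ.filter fun j => t ≤ lam j with hUt
    have hUt_ne : Ut.Nonempty := ⟨σ ⟨l + 1, hl1⟩, by simp [hUt, ht]⟩
    have hUt_lt : Ut.card < k := by
      have : σ ⟨l, by omega⟩ ∉ Ut := by simp [hUt, not_le.mpr hgap]
      calc Ut.card < (Finset.univ : Finset (Fin k)).card :=
            Finset.card_lt_card (Finset.ssubset_iff_subset_ne.mpr ⟨Finset.subset_univ _,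
              fun h => this (h ▸ Finset.mem_univ _)⟩)
        _ = k := by simp
    have hUt_ge : k - (l + 1) ≤ Ut.card := by
      -- `Ut ⊇ σ '' {m : l+1 ≤ m}`
      have hsub : (Finset.univ.filter fun m : Fin k => l + 1 ≤ (m : ℕ)).image σ ⊆ Ut := by
        intro j hj
        obtain ⟨m, hm, rfl⟩ := Finset.mem_image.mp hj
        simp only [Finset.mem_filter, Finset.mem_univ, true_and] at hm
        simp only [hUt, Finset.mem_filter, Finset.mem_univ, true_and, ht]
        exact hmono (show (⟨l + 1, hl1⟩ : Fin k) ≤ m from hm)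
      calc k - (l + 1) = (Finset.Ici (⟨l + 1, hl1⟩ : Fin k)).card := by rw [Fin.card_Ici]
        _ = ((Finset.univ.filter fun m : Fin k => l + 1 ≤ (m : ℕ))).card := by
            congr 1; ext m; simp [Finset.mem_Ici, Fin.le_def]
        _ = ((Finset.univ.filter fun m : Fin k => l + 1 ≤ (m : ℕ)).image σ).card :=
            (Finset.card_image_of_injective _ σ.injective).symm
        _ ≤ Ut.card := Finset.card_le_card hsub
    have hc := hcount t hUt_ne hUt_lt
    -- `{x : p x ≤ l} ⊆ {x : λ_{f x} < t}`
    have hsub2 : (Finset.univ.filter fun x => ¬ l < p x) ⊆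
        (Finset.univ.filter fun x => lam (f x) < t) := by
      intro x hx
      simp only [Finset.mem_filter, Finset.mem_univ, true_and, not_lt] at hx ⊢
      have h1 : lam (f x) = (lam ∘ σ) (σ.symm (f x)) := by simp
      rw [h1]
      calc (lam ∘ σ) (σ.symm (f x)) ≤ (lam ∘ σ) ⟨l, by omega⟩ := hmono (show _ ≤ _ from by
              change (σ.symm (f x) : ℕ) ≤ l; exact hx)
        _ < t := hgap
    have hcompl : ((Finset.univ.filter fun x => l < p x).card : ℝ) =
        n - ((Finset.univ.filter fun x => ¬ l < p x).card : ℝ) := by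
      have := Finset.card_filter_add_card_filter_not (s := (Finset.univ : Finset X)) (fun x => l < p x)
      rw [Finset.card_univ] at this
      have h' : ((Finset.univ.filter fun x => l < p x).card : ℝ) +
          ((Finset.univ.filter fun x => ¬ l < p x).card : ℝ) = n := by exact_mod_cast this
      linarith
    rw [hcompl]
    have h3 : ((Finset.univ.filter fun x => ¬ l < p x).card : ℝ) ≤ l + 1 := by
      have := (Finset.card_le_card hsub2).trans hc
      have h4 : (k - Ut.card : ℕ) ≤ l + 1 := by omega
      exact_mod_cast this.trans h4
    linarith
  -- assemble
  have hkpos : (0 : ℝ) < k := by exact_mod_cast hk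
  have hnk : (0 : ℝ) ≤ ((n : ℝ) - k) / k := div_nonneg (by rw [sub_nonneg]; exact_mod_cast hn) hkpos.le
  have hD : ∑ x, Real.log (lam (f x)) - (n : ℝ) / k * ∑ j, Real.log (lam j) =
      ∑ l ∈ Finset.range (k - 1), g l *
        (((Finset.univ.filter fun x => l < p x).card : ℝ) - (n : ℝ) / k * ((k : ℝ) - 1 - l)) := by
    rw [hA, hB, mul_add, Finset.mul_sum]
    have : (n : ℝ) / k * (k * ν 0) = n * ν 0 := by field_simp
    rw [this]
    rw [show (n : ℝ) * ν 0 + ∑ l ∈ Finset.range (k - 1), g l * ((Finset.univ.filter fun x => l < p x).card : ℝ) -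
        ((n : ℝ) * ν 0 + ∑ l ∈ Finset.range (k - 1), (n : ℝ) / k * (g l * ((k : ℝ) - 1 - l))) =
        ∑ l ∈ Finset.range (k - 1), g l * ((Finset.univ.filter fun x => l < p x).card : ℝ) -
        ∑ l ∈ Finset.range (k - 1), (n : ℝ) / k * (g l * ((k : ℝ) - 1 - l)) by ring]
    rw [← Finset.sum_sub_distrib]
    exact Finset.sum_congr rfl fun l _ => by ring
  have hlow : ∑ l ∈ Finset.range (k - 1), g l * (((n : ℝ) - k) / k) ≤
      ∑ l ∈ Finset.range (k - 1), g l *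
        (((Finset.univ.filter fun x => l < p x).card : ℝ) - (n : ℝ) / k * ((k : ℝ) - 1 - l)) := by
    refine Finset.sum_le_sum fun l hl => ?_
    have hl' : l < k - 1 := Finset.mem_range.mp hl
    have h1 := hN l hl'
    -- `g (n-l-1) - g (n/k)(k-1-l) = g (l+1)(n-k)/k ≥ g (n-k)/k`
    have hl1 : (1 : ℝ) ≤ l + 1 := by linarith [Nat.cast_nonneg (α := ℝ) l]
    have key : g l * (((n : ℝ) - k) / k) ≤ g l * (((n : ℝ) - l - 1) - (n : ℝ) / k * ((k : ℝ) - 1 - l)) := by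
      have : ((n : ℝ) - l - 1) - (n : ℝ) / k * ((k : ℝ) - 1 - l) = ((l : ℝ) + 1) * (((n : ℝ) - k) / k) := by
        field_simp; ring
      rw [this]
      calc g l * (((n : ℝ) - k) / k) = g l * (1 * (((n : ℝ) - k) / k)) := by ring
        _ ≤ g l * (((l : ℝ) + 1) * (((n : ℝ) - k) / k)) :=
            mul_le_mul_of_nonneg_left (mul_le_mul_of_nonneg_right hl1 hnk) (hg0 l)
    nlinarith [h1, hg0 l, hnk]
  have hsumg : ∑ l ∈ Finset.range (k - 1), g l = ν (k - 1) - ν 0 := Finset.sum_range_sub ν (k - 1)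
  have hends : Real.log (lam jM) - Real.log (lam jm) ≤ ν (k - 1) - ν 0 := by
    have hM : Real.log (lam jM) ≤ ν (k - 1) := by
      simp only [ν]
      refine Real.log_le_log (hpos _) ?_
      have : lam jM = (lam ∘ σ) (σ.symm jM) := by simp
      rw [this]
      exact hmono (show σ.symm jM ≤ idx (k - 1) from by
        change (σ.symm jM : ℕ) ≤ min (k - 1) (k - 1); have := (σ.symm jM).isLt; omega)
    have hm : ν 0 ≤ Real.log (lam jm) := by
      simp only [ν]
      refine Real.log_le_log (hpos _) ?_
      have : lam jm = (lam ∘ σ) (σ.symm jm) := by simp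
      rw [this]
      exact hmono (show idx 0 ≤ σ.symm jm from by change min 0 (k - 1) ≤ (σ.symm jm : ℕ); omega)
    linarith
  calc ((n : ℝ) - k) / k * (Real.log (lam jM) - Real.log (lam jm))
      ≤ ((n : ℝ) - k) / k * (ν (k - 1) - ν 0) := mul_le_mul_of_nonneg_left hends hnk
    _ = ∑ l ∈ Finset.range (k - 1), g l * (((n : ℝ) - k) / k) := by rw [← Finset.sum_mul, hsumg, mul_comm]
    _ ≤ _ := hlow
    _ = _ := hD.symm

/-! ## Coercivity -/

/-- **Coercivity of the log-volume functional on the unit Frobenius sphere.**  Let `u : X → ℝ^k`,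
`|X| ≥ k ≥ 1`, with `‖u_x‖² ≥ kδ₀`, in QUANTITATIVE GENERAL POSITION with constant `δ₀ > 0`: for
every orthonormal basis `(e_j)` and every nonempty `U ⊊ [k]`, at most `k − |U|` of the `u_x` have
`⟨e_i,u_x⟩² < δ₀` for all `i ∈ U`.  Then for every `A` with `∑ A_{ij}² = 1` and `det A ≠ 0`,
`|X| log δ₀ − ((|X|−k)/k) log k + ((|X|−k)/k²) log(1/(det A)²) ≤ ∑_x log ‖Au_x‖² − (|X|/k) log (det A)²`.
[cite: Forster2002, Lemma 4.2 (compactness; variational form)] -/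
theorem coercive_bound {X : Type*} [Fintype X] {k : ℕ} (u : X → Fin k → ℝ) (hk : 1 ≤ k)
    (hn : k ≤ Fintype.card X) {δ₀ : ℝ} (hδ₀ : 0 < δ₀) (hδu : ∀ x, (k : ℝ) * δ₀ ≤ u x ⬝ᵥ u x)
    (hGP : ∀ e : Fin k → Fin k → ℝ, (∀ i j, e i ⬝ᵥ e j = if i = j then 1 else 0) →
      ∀ U : Finset (Fin k), U.Nonempty → U.card < k →
        (Finset.univ.filter fun x => ∀ i ∈ U, (e i ⬝ᵥ u x) ^ 2 < δ₀).card ≤ k - U.card)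
    (A : Matrix (Fin k) (Fin k) ℝ) (hA1 : ∑ i, ∑ j, A i j ^ 2 = 1) (hAdet : A.det ≠ 0) :
    (Fintype.card X : ℝ) * Real.log δ₀ - ((Fintype.card X : ℝ) - k) / k * Real.log k
      + ((Fintype.card X : ℝ) - k) / k ^ 2 * Real.log (1 / A.det ^ 2) ≤
    ∑ x, Real.log ((A *ᵥ u x) ⬝ᵥ (A *ᵥ u x)) - (Fintype.card X : ℝ) / k * Real.log (A.det ^ 2) := by
  classical
  obtain ⟨lam, e, horth, hexp, hpars, htr, hdet, hnn⟩ := spectral_data A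
  set n : ℕ := Fintype.card X with hndef
  have hkpos : (0 : ℝ) < k := by exact_mod_cast hk
  -- positivity of the eigenvalues
  have hdet2 : 0 < A.det ^ 2 := by positivity
  have hlpos : ∀ j, 0 < lam j := by
    intro j
    rcases eq_or_lt_of_le (hnn j) with h0 | hpos
    · exfalso
      have : ∏ i, lam i = 0 := Finset.prod_eq_zero (Finset.mem_univ j) h0.symm
      rw [hdet] at this
      exact hdet2.ne' this
    · exact hpos
  have hsum1 : ∑ j, lam j = 1 := by rw [htr, hA1]
  have hle1 : ∀ j, lam j ≤ 1 := fun j => by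
    rw [← hsum1]; exact Finset.single_le_sum (fun i _ => hnn i) (Finset.mem_univ j)
  -- for each `x`, the largest eigenvalue among the directions that see `u_x`
  have hJ : ∀ x, ∃ j, δ₀ ≤ (e j ⬝ᵥ u x) ^ 2 ∧ ∀ j', δ₀ ≤ (e j' ⬝ᵥ u x) ^ 2 → lam j' ≤ lam j := by
    intro x
    have hne : (Finset.univ.filter fun j => δ₀ ≤ (e j ⬝ᵥ u x) ^ 2).Nonempty := by
      by_contra hemp
      rw [Finset.not_nonempty_iff_eq_empty] at hemp
      have hall : ∀ j, (e j ⬝ᵥ u x) ^ 2 < δ₀ := by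
        intro j
        by_contra hj
        have : j ∈ (Finset.univ.filter fun j => δ₀ ≤ (e j ⬝ᵥ u x) ^ 2) := by
          simp [not_lt.mp hj]
        rw [hemp] at this
        exact absurd this (Finset.notMem_empty j)
      have hlt : u x ⬝ᵥ u x < k * δ₀ := by
        rw [hpars]
        calc ∑ j, (e j ⬝ᵥ u x) ^ 2 < ∑ _j : Fin k, δ₀ :=
              Finset.sum_lt_sum_of_nonempty ⟨⟨0, hk⟩, Finset.mem_univ _⟩ fun j _ => hall j
          _ = k * δ₀ := by rw [Finset.sum_const, Finset.card_univ, Fintype.card_fin, nsmul_eq_mul]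
      linarith [hδu x]
    obtain ⟨j, hj, hmax⟩ := Finset.exists_max_image _ lam hne
    refine ⟨j, (Finset.mem_filter.mp hj).2, fun j' hj' => hmax j' ?_⟩
    simp [hj']
  choose f hf hfmax using hJ
  -- `‖A u_x‖² ≥ λ_{f x} δ₀`
  have hAu : ∀ x, lam (f x) * δ₀ ≤ (A *ᵥ u x) ⬝ᵥ (A *ᵥ u x) := by
    intro x
    rw [hexp]
    calc lam (f x) * δ₀ ≤ lam (f x) * (e (f x) ⬝ᵥ u x) ^ 2 :=
          mul_le_mul_of_nonneg_left (hf x) (hnn _)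
      _ ≤ ∑ j, lam j * (e j ⬝ᵥ u x) ^ 2 :=
          Finset.single_le_sum (f := fun j => lam j * (e j ⬝ᵥ u x) ^ 2)
            (fun j _ => mul_nonneg (hnn j) (sq_nonneg _)) (Finset.mem_univ (f x))
  have hlogAu : ∀ x, Real.log δ₀ + Real.log (lam (f x)) ≤ Real.log ((A *ᵥ u x) ⬝ᵥ (A *ᵥ u x)) := by
    intro x
    rw [← Real.log_mul hδ₀.ne' (hlpos _).ne', mul_comm]
    exact Real.log_le_log (mul_pos (hlpos _) hδ₀) (hAu x)
  -- the counting hypothesis of the layer cake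
  have hcount : ∀ t : ℝ, (Finset.univ.filter fun j => t ≤ lam j).Nonempty →
      (Finset.univ.filter fun j => t ≤ lam j).card < k →
      (Finset.univ.filter fun x => lam (f x) < t).card ≤
        k - (Finset.univ.filter fun j => t ≤ lam j).card := by
    intro t hne hlt
    refine le_trans (Finset.card_le_card ?_) (hGP e horth _ hne hlt)
    intro x hx
    simp only [Finset.mem_filter, Finset.mem_univ, true_and] at hx ⊢
    intro i hi
    by_contra hge
    have := hfmax x i (not_lt.mp hge)
    linarith
  -- layer cake with `jM` = argmax, `jm` = argmin of `λ`
  obtain ⟨jM, -, hjM⟩ := Finset.exists_max_image Finset.univ lam ⟨⟨0, hk⟩, Finset.mem_univ _⟩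
  obtain ⟨jm, -, hjm⟩ := Finset.exists_min_image Finset.univ lam ⟨⟨0, hk⟩, Finset.mem_univ _⟩
  have hcake := layer_cake hk hn lam hlpos f hcount jM jm
  rw [← hndef] at hcake
  -- `λ_max ≥ 1/k`, `k log λ_min ≤ log det²`
  have hmax : 1 / (k : ℝ) ≤ lam jM := by
    have : (1 : ℝ) = ∑ j, lam j := hsum1.symm
    have h2 : ∑ j, lam j ≤ ∑ _j : Fin k, lam jM := Finset.sum_le_sum fun j _ => hjM j (Finset.mem_univ _)
    rw [Finset.sum_const, Finset.card_univ, Fintype.card_fin, nsmul_eq_mul] at h2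
    rw [div_le_iff₀ hkpos]; linarith
  have hmin : (k : ℝ) * Real.log (lam jm) ≤ Real.log (A.det ^ 2) := by
    rw [← hdet, Real.log_prod (s := Finset.univ) (fun j _ => (hlpos j).ne')]
    calc (k : ℝ) * Real.log (lam jm) = ∑ _j : Fin k, Real.log (lam jm) := by
          rw [Finset.sum_const, Finset.card_univ, Fintype.card_fin, nsmul_eq_mul]
      _ ≤ ∑ j, Real.log (lam j) :=
          Finset.sum_le_sum fun j _ => Real.log_le_log (hlpos _) (hjm j (Finset.mem_univ _))
  have hlogdet : Real.log (A.det ^ 2) = ∑ j, Real.log (lam j) := by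
    rw [← hdet, Real.log_prod (s := Finset.univ) (fun j _ => (hlpos j).ne')]
  rw [← hlogdet] at hcake
  -- assemble
  have hS : (n : ℝ) * Real.log δ₀ + ∑ x, Real.log (lam (f x)) ≤
      ∑ x, Real.log ((A *ᵥ u x) ⬝ᵥ (A *ᵥ u x)) := by
    calc (n : ℝ) * Real.log δ₀ + ∑ x, Real.log (lam (f x))
        = ∑ x, (Real.log δ₀ + Real.log (lam (f x))) := by
          rw [Finset.sum_add_distrib, Finset.sum_const, Finset.card_univ, nsmul_eq_mul]
      _ ≤ _ := Finset.sum_le_sum fun x _ => hlogAu x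
  have hnk : (0 : ℝ) ≤ ((n : ℝ) - k) / k := div_nonneg (by rw [sub_nonneg]; exact_mod_cast hn) hkpos.le
  have hlogk : Real.log (lam jM) ≥ -Real.log k := by
    have := Real.log_le_log (by positivity) hmax
    rw [one_div, Real.log_inv] at this
    exact this
  have hlogmin : Real.log (lam jm) ≤ (1 / k) * Real.log (A.det ^ 2) := by
    rw [one_div, le_inv_mul_iff₀ hkpos]; exact hmin
  rw [one_div, Real.log_inv]
  have h1 : ((n : ℝ) - k) / k * (Real.log (lam jM) - Real.log (lam jm)) ≥
      ((n : ℝ) - k) / k * (-Real.log k - (1 / k) * Real.log (A.det ^ 2)) :=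
    mul_le_mul_of_nonneg_left (by linarith) hnk
  have h2 : ((n : ℝ) - k) / k * (-Real.log k - (1 / k) * Real.log (A.det ^ 2)) =
      -(((n : ℝ) - k) / k * Real.log k) + ((n : ℝ) - k) / k ^ 2 * (-Real.log (A.det ^ 2)) := by
    field_simp; ring
  linarith [hcake, hS, h1, h2, hlogdet]

end Summit.QuantumAdvantage.QuantumAdvantage.Theorems.HankelLift.Forster
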